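import Literature.AlgebraicGeometry.Resolution.MaximalContact
import Mathlib.AlgebraicGeometry.Morphisms.Smooth
import Mathlib.Algebra.CharP.Basic
import Mathlib.FieldTheory.Perfect
import HarnessLib

/-!
# `SigmaMaxModificationsCorridor3` (stmt-19249), line `tame_wild`, helper H2 of `stub_tameNu3`:
# maximal contact exists at every point of the support of a TAME marked ideal

[OURS · L1 W4.2] First brick of the H2/H4 architecture of the transfer stub `stub_tameNu3` (CRUX-PLAN v1 §2,
lead's `TameArchitecture.lean`): on a scheme `X` smooth over a perfect field `k` of characteristic `p`, a
marked ideal `(𝓘, E, m)` with `1 ≤ m < p` whose order is `≤ m` everywhere (the marking is the MAXIMAL order —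
the situation `𝓘 = 𝓘_Y`, `m` = the multiplicity of a tame maximal Hilbert–Samuel value) is of maximal order
in the sense of BGMW Def. 3.6.1 (`𝒟^m(𝓘) = 𝒪_X`), because `1, …, m` are units in every local ring
(`isUnit_natCast_stalk_of_lt_char`); hence (`MarkedIdeal.exists_maximalContact_of_smooth`, BGMW Lemma 3.6.4)
every point of `supp(𝓘, m)` has an affine neighbourhood `U` and a section `u ∈ 𝒟^{m-1}(𝓘)(U)` of order one
along `V(u) ∩ U` whose hypersurface is regular and contains `supp(𝓘, m) ∩ U` — Giraud's hypersurface of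
maximal contact for `ord < p`. NOT a statement of any manuscript.

* `isUnit_natCast_stalk_of_lt_char` — `0 < j < p ⇒ j ∈ 𝒪_{X,x}^×` for `X` over a field of characteristic `p`;
* `isOfMaxOrder_of_mult_lt_char` — `(𝓘, E, m)` with `m < p` and `ord ≤ m` everywhere is of maximal order;
* `exists_maximalContact_of_mult_lt_char` — maximal contact at every point of the support.

## Sources
* E. Bierstone, D. Grigoriev, P. Milman, J. Włodarczyk, *Effective Hironaka resolution and its complexity*,
  Asian J. Math. 15 (2011), Def. 3.6.1, Lemma 3.6.4, Thm. 8.0.4. [BierstoneGrigorievMilmanWlodarczyk2011]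
* J. Giraud, *Contact maximal en caractéristique positive*, Ann. Sci. ÉNS 8 (1975). [Giraud1975]
-/

set_option linter.dupNamespace false -- mandated namespace of this single-conjunct summit

noncomputable section

open CategoryTheory AlgebraicGeometry TopologicalSpace Topology IsLocalRing
open Literature.AlgebraicGeometry.Resolution

namespace Summit.ResolutionOfSingularities.ResolutionOfSingularities.Theorems.SigmaMaxModificationsCorridor3.TameWild

variable (k : Type) [Field k] (X : Scheme.{0}) [X.Over (Spec (.of k))]

/-- Over a field of characteristic `p`, every integer `0 < j < p` is a unit in every local ring
`𝒪_{X,x}` (it is the image of the unit `j ∈ k^×` under `k → Γ(X, 𝒪_X) → 𝒪_{X,x}`). [folklore] -/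
theorem isUnit_natCast_stalk_of_lt_char {p : ℕ} [CharP k p] (x : X) {j : ℕ} (hj0 : 0 < j)
    (hjp : j < p) : IsUnit (j : X.presheaf.stalk x) := by
  have hk : IsUnit (j : k) := by
    rw [isUnit_iff_ne_zero, Ne, CharP.cast_eq_zero_iff k p j]
    exact fun h => absurd (Nat.le_of_dvd hj0 h) (not_le.mpr hjp)
  simpa using hk.map ((X.presheaf.germ ⊤ x trivial).hom.comp (overHom k X))

/-- **A marked ideal `(𝓘, E, m)` with `m < p = char k` and `ord_x 𝓘 ≤ m` for all `x` is of maximal order**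
(`𝒟^m(𝓘) = 𝒪_X`, BGMW Def. 3.6.1), on `X` smooth over the perfect field `k`: the two formulations of
"maximal order" agree as soon as `1, …, m` are units in the local rings (BGMW Thm. 8.0.4's range `m < p`).
[cite: BierstoneGrigorievMilmanWlodarczyk2011, Def. 3.6.1, Thm. 8.0.4] -/
theorem isOfMaxOrder_of_mult_lt_char {p : ℕ} [CharP k p] [PerfectField k]
    [Smooth (X ↘ Spec (.of k))] (M : MarkedIdeal X) (hμp : M.mult < p)
    (hord : ∀ x : X, idealOrder M.ideal x ≤ M.mult) : M.IsOfMaxOrder (overHom k X) :=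
  (MarkedIdeal.isOfMaxOrder_iff_forall_idealOrder_le (hasFinitePresentationDifferentials_overHom k X)
    (hasLocalCoordinates_overHom k X) M
    (fun x _ hj hjm => isUnit_natCast_stalk_of_lt_char k X x hj (lt_of_le_of_lt hjm hμp))).mpr hord

/-- **Maximal contact at every point of the support of a tame marked ideal** (Giraud 1975 for `ord < p`;
BGMW Lemma 3.6.4 (1)–(2) via `MarkedIdeal.exists_maximalContact_of_smooth`): for `X` smooth over a perfect
field `k` of characteristic `p` and `(𝓘, E, m)` with `1 ≤ m < p` and `ord_x 𝓘 ≤ m` everywhere, every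
`x ∈ supp(𝓘, m)` has an affine open `U ∋ x` and `u ∈ 𝒟^{m-1}(𝓘)(U)`, vanishing at `x`, of order one at every
point of `U`, with `V(u) = Spec (Γ(X,U)/(u))` regular and `supp(𝓘, m) ∩ U ⊆ V(u)`.
[cite: BierstoneGrigorievMilmanWlodarczyk2011, Lemma 3.6.4 (1)–(2), Thm. 8.0.4] [cite: Giraud1975] -/
theorem exists_maximalContact_of_mult_lt_char {p : ℕ} [CharP k p] [PerfectField k]
    [Smooth (X ↘ Spec (.of k))] (M : MarkedIdeal X) (hμ : 1 ≤ M.mult) (hμp : M.mult < p)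
    (hord : ∀ x : X, idealOrder M.ideal x ≤ M.mult) {x : X} (hx : x ∈ M.support) :
    ∃ (U : X.affineOpens) (hxU : x ∈ (U : X.Opens)) (u : Γ(X, U)),
      u ∈ (derivIdealSheafIter (overHom k X) (M.mult - 1) M.ideal).ideal U ∧
        X.presheaf.germ U x hxU u ∈ maximalIdeal (X.presheaf.stalk x) ∧
        (∀ (y : X) (hy : y ∈ (U : X.Opens)),
          X.presheaf.germ U y hy u ∉ maximalIdeal (X.presheaf.stalk y) ^ 2) ∧
        Scheme.IsRegular (Spec (.of (Γ(X, U) ⧸ Ideal.span {u}))) ∧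
        M.support ∩ (U : Set X) ⊆ X.zeroLocus (U := U) {u} :=
  MarkedIdeal.exists_maximalContact_of_smooth k X (isOfMaxOrder_of_mult_lt_char k X M hμp hord) hμ hx

/-- In the tame situation the support is exactly the locus of order `m` (order `≤ m` everywhere, `≥ m` on
the support). [folklore] -/
theorem idealOrder_eq_of_mem_support (M : MarkedIdeal X) (hord : ∀ x : X, idealOrder M.ideal x ≤ M.mult)
    {x : X} (hx : x ∈ M.support) : idealOrder M.ideal x = M.mult :=
  le_antisymm (hord x) hx

end Summit.ResolutionOfSingularities.ResolutionOfSingularities.Theorems.SigmaMaxModificationsCorridor3.TameWild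

end
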